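import Summits.ResolutionOfSingularities.ResolutionOfSingularities.Theorems.PerronSigmaStep
import HarnessLib

/-!
# PerronSigmaAscent — decomp-res node «DefectlessLadder» (lens-1 g19, Σ₁ hygiene of «PerronLadder»), tree
file 3/3 of the Σ₁ part

Content VERBATIM from the decomp-res lens-1 g19 rev 1 TREE-FACING COMPANION
`HOME/decomp-res-lens-1/g19/tree/DefectlessLadderTree.lean`
(sha256 45a9879c65cfd008…, 1724 l, rc 0 · 0 sorry · axioms standard per the lens's `tree/*.json`; it is the tree
projection of the node
`g19/DefectlessLadder.lean` bf11eb22…, CRITIC-LEDGER row 145, decomp-res-crit-1 g5 2026-08-30T21:39:44Z «URGENT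
HYGIENE (cn26)», landing plan
(K)(L)(M)(N) of the lens's WRITER.md rev 1, endorsed).  HOME = run/shared/lean/pub/decomp-res.  WHY: the landed g18 port
`PerronCharts.MonoidalStep` is REFUTABLE AS TYPED (parameter families with a repeated non-unit member;
`not_isParamFamily_of_mul_mem`),
so the landed `PerronLadder.toricAscentRk1_three` / `closes_perron*` carry a vacuous binder `(hStep : MonoidalStep)`
— sound, not citable.
These files add the corrected statement `MonoidalStepD` (distinct non-unit members), PROVE it in kernel
(`monoidalStepD_holds`, tree file
`PerronSigmaStep`), and re-thread PART V to the Σ₁-FREE closure `closes_sigma` (tree file `PerronSigmaAscent`)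
— pure additions under FRESH
names in the companion's namespace `…Theorems.DefectlessLadder`; no landed statement is edited.  Landed by
decomp-res writer g7 as SUPPORT
(helper) of the Valuative route item 0641 `LuAlphaPTorsor`; no Valuative route edit is made by the decomp-res cell
(MonoidalStep must simply never be
filed or served as an item; the closure now runs modulo floor CP2019 + CJS2020 + Π₁ `KK05NCVAscent` + the
residual family `NonKHToricArchLU 3 3 d`
+ `PatchingRel`).

C · `valIndep_upgradeD` (the tree's `valIndep_upgrade` re-typed over `MonoidalStepD`, `NonunitDistinct` threaded
through the merge induction)
+ `valIndep_upgrade_sigma`; D · `isParamFamily_comp_succAbove`, `isMonomialIn_comp_succAbove`,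
`exists_dedup_paramFamily` (so the LANDED
`exists_initial_chart` feeds `valIndep_upgradeD` unchanged); E · `toricAscent_core_sigma`,
**`toricAscentRk1_three_sigma (hCJS) (hAsc) : ToricAscentRk1 3`**
(Σ₁ DISCHARGED — supersedes the landed `toricAscentRk1_three (hStep : MonoidalStep)`); F · the Σ₁-free cuts
and closures `…_sigma` superseding the landed
`…_perron` family: `closes_sigma (hCP) (hCJS) (hAsc) (hN) (h₃) : ResolutionOfSingularities`,
`root_iff_nonKHToric_sigma`, …, `monoidalStepD_iff_true`.
PROVED, 0 sorry.

(Sources: de Jong 1996 (2.4) / Stacks 0BIQ (blow-up charts); CossartPiltant2019; CossartJannsenSaito2020;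
KnafKuhlmann2005 arXiv:math/0304159 §4 Thm 4.1; Zariski1940 §B; Cutkosky arXiv:1404.7459 §2.1; Kaplansky1942
Lemma 5, Thm 3; Kuhlmann2010 arXiv:1003.5678 Lemma 2.4, Thm 2.14; KnafKuhlmann2009 Lemma 2.16.)
-/

noncomputable section

open IsLocalRing Literature.AlgebraicGeometry.Resolution
open Summit.ResolutionOfSingularities.ResolutionOfSingularities.Theses
open Summit.ResolutionOfSingularities.ResolutionOfSingularities.Theorems
open Summit.ResolutionOfSingularities.ResolutionOfSingularities.Theorems.PfaffLine
open Summit.ResolutionOfSingularities.ResolutionOfSingularities.Theorems.ToricLadder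
open Summit.ResolutionOfSingularities.ResolutionOfSingularities.Theorems.KaplanskyLadder
open Summit.ResolutionOfSingularities.ResolutionOfSingularities.Theorems.PerronLadder

namespace Summit.ResolutionOfSingularities.ResolutionOfSingularities.Theorems.DefectlessLadder

/-! # C · The (V)-upgrade re-typed over `MonoidalStepD` (node §19, REV gen 19) -/

section UpgradeD

variable {k : Type} [Field k] {K : Type} [Field K] [Algebra k K] (O : ValuationSubring K)
  [hr : O.valuation.RankOne]

/-- **KERNEL · THE (V)-UPGRADE.** For a rank-one valuation, a regular local chart with a parameter
family of at most three members and a finite set of monomials in it can be replaced — by finitely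
many monoidal steps (the port `MonoidalStep`), chosen by the Perron–Euclid merging lemma
`mergeReachable_of_le_three` — by a chart in which the same elements are still monomials and the
values of the non-unit parameters are `ℤ`-INDEPENDENT (Knaf–Kuhlmann's condition (V)). [folklore] -/
theorem valIndep_upgradeD (hStep : MonoidalStepD) (hk : ∀ c : k, algebraMap k K c ∈ O)
    (F₁ : IntermediateField k K) {m : ℕ} (hm : m ≤ 3) (S : Subalgebra k K) (t : Fin m → K)
    (hS : RegChart O F₁ S) (ht : IsParamFamily O S t) (hdt : NonunitDistinct O t) (W : Finset K)
    (hW : ∀ c ∈ W, IsMonomialIn O S t c) :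
    ∃ (S₁ : Subalgebra k K) (t₁ : Fin m → K), S ≤ S₁ ∧ RegChart O F₁ S₁ ∧ IsParamFamily O S₁ t₁ ∧
      (∀ c ∈ W, IsMonomialIn O S₁ t₁ c) ∧ ValIndepFamily O t₁ := by
  have key : ∀ τ : Fin m → ℝ, MergeReachable τ → ∀ (S : Subalgebra k K) (t : Fin m → K),
      (τ = fun i => lv O (t i)) → RegChart O F₁ S → IsParamFamily O S t → NonunitDistinct O t →
      (∀ c ∈ W, IsMonomialIn O S t c) →
      ∃ (S₁ : Subalgebra k K) (t₁ : Fin m → K), S ≤ S₁ ∧ RegChart O F₁ S₁ ∧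
        IsParamFamily O S₁ t₁ ∧ (∀ c ∈ W, IsMonomialIn O S₁ t₁ c) ∧ ValIndepFamily O t₁ := by
    intro τ hτ
    induction hτ with
    | done τ h =>
      intro S t hτt hS ht _ hW
      refine ⟨S, t, le_rfl, hS, ht, hW, ?_⟩
      subst hτt
      exact valIndepFamily_of_done O (fun i => (ht.1 i).2) h
    | step τ i s his hs hle hM IH =>
      intro S t hτt hS ht hdt hW
      subst hτt
      have hti : t i ∈ S ∧ t i ≠ 0 := ht.1 i
      have hts : t s ∈ S ∧ t s ≠ 0 := ht.1 s
      have htsO : t s ∈ O := hS.2.1 hts.1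
      have htiO : t i ∈ O := hS.2.1 hti.1
      have hvs : O.valuation (t s) < 1 := (lv_pos_iff O htsO hts.2).mp hs
      have hvi : O.valuation (t i) ≤ O.valuation (t s) := (lv_le_lv_iff O hts.2 hti.2).mp hle
      obtain ⟨S₁, hSS₁, hS₁, ht₁, hdt₁⟩ := hStep k K O hk F₁ S hS m t ht hdt i s his hvs hvi
      have hτ₁ : Function.update (fun j => lv O (t j)) i (lv O (t i) - lv O (t s)) =
          fun j => lv O (Function.update t i (t i / t s) j) := by
        funext j
        by_cases hji : j = i
        · subst hji
          simp only [Function.update_self]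
          rw [lv_div O hti.2 hts.2]
        · rw [Function.update_of_ne hji, Function.update_of_ne hji]
      obtain ⟨S₂, t₂, hS₁S₂, hS₂, ht₂, hW₂, hV⟩ := IH S₁ _ hτ₁ hS₁ ht₁ hdt₁
        (fun c hc => (hW c hc).update hSS₁ his hts.2)
      exact ⟨S₂, t₂, hSS₁.trans hS₁S₂, hS₂, ht₂, hW₂, hV⟩
  exact key _ (mergeReachable_of_le_three hm _ fun i => lv_nonneg O (hS.2.1 (ht.1 i).1))
    S t rfl hS ht hdt hW

/-! ## 29. Σ₁-free closure: PART V's theorems with the hypothesis `MonoidalStepD` DISCHARGED -/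

/-- `valIndep_upgrade_sigma`: Auxiliary step of this node's calculus, VERBATIM from the lens file (see the module
docstring); the statement is its type. [folklore] -/
theorem valIndep_upgrade_sigma (O : ValuationSubring K) [O.valuation.RankOne] (hk : ∀ c : k, algebraMap k K c ∈ O)
    (F₁ : IntermediateField k K) {m : ℕ} (hm : m ≤ 3) (S : Subalgebra k K) (t : Fin m → K)
    (hS : RegChart O F₁ S) (ht : IsParamFamily O S t) (hdt : NonunitDistinct O t) (W : Finset K)
    (hW : ∀ c ∈ W, IsMonomialIn O S t c) :
    ∃ (S₁ : Subalgebra k K) (t₁ : Fin m → K), S ≤ S₁ ∧ RegChart O F₁ S₁ ∧ IsParamFamily O S₁ t₁ ∧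
      (∀ c ∈ W, IsMonomialIn O S₁ t₁ c) ∧ ValIndepFamily O t₁ :=
  valIndep_upgradeD O monoidalStepD_holds hk F₁ hm S t hS ht hdt W hW

end UpgradeD

/-! # D · De-duplication of a parameter family (so that the landed `exists_initial_chart` feeds `valIndep_upgradeD`) -/

section Dedup

variable {k : Type} [Field k] {K : Type} [Field K] [Algebra k K]

/-- Dropping the member `l` of a parameter family keeps it a parameter family. [folklore] -/
theorem isParamFamily_comp_succAbove (O : ValuationSubring K) (S : Subalgebra k K) {n : ℕ}
    (t : Fin (n + 1) → K) (ht : IsParamFamily O S t) (l : Fin (n + 1)) :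
    IsParamFamily O S (fun i => t (l.succAbove i)) := by
  obtain ⟨h1, d, z, hd, hz, hsp, hmem⟩ := ht
  exact ⟨fun i => h1 _, d, z, hd, hz, hsp, fun i => hmem _⟩

/-- If `t l = t j` with `j ≠ l`, every monomial in `t` is a monomial in `t` with the member `l` dropped
(its exponent is moved onto `j`). [folklore] -/
theorem isMonomialIn_comp_succAbove (O : ValuationSubring K) (S : Subalgebra k K) {n : ℕ}
    (t : Fin (n + 1) → K) {j l : Fin (n + 1)} (hjl : j ≠ l) (htjl : t j = t l) {c : K}
    (hc : IsMonomialIn O S t c) : IsMonomialIn O S (fun i => t (l.succAbove i)) c := by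
  classical
  obtain ⟨u, huS, hu1, α, rfl⟩ := hc
  obtain ⟨j', hj'⟩ := Fin.exists_succAbove_eq hjl
  refine ⟨u, huS, hu1, fun i => α (l.succAbove i) + if i = j' then α l else 0, ?_⟩
  have key : (∏ x, t (l.succAbove x) ^ (if x = j' then α l else 0)) = t l ^ α l := by
    rw [Finset.prod_eq_single j' (fun b _ hb => by simp [hb]) (fun h => absurd (Finset.mem_univ _) h)]
    simp [hj', htjl]
  rw [Fin.prod_univ_succAbove _ l]
  simp_rw [pow_add, Finset.prod_mul_distrib, key]
  ring

/-- **De-duplication.**  A parameter family `t : Fin d → K` of `S` is replaced by one with `≤ d` members,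
injective on its non-unit members (`NonunitDistinct`), in which the same finite set of elements are still
monomials. [folklore] -/
theorem exists_dedup_paramFamily (O : ValuationSubring K) (S : Subalgebra k K) :
    ∀ {d : ℕ} (t : Fin d → K), IsParamFamily O S t → ∀ (W : Finset K),
      (∀ c ∈ W, IsMonomialIn O S t c) →
      ∃ (d' : ℕ) (t' : Fin d' → K), d' ≤ d ∧ IsParamFamily O S t' ∧ NonunitDistinct O t' ∧
        ∀ c ∈ W, IsMonomialIn O S t' c := by
  intro d
  induction d with
  | zero =>
    intro t ht W hW
    exact ⟨0, t, le_rfl, ht, fun j => Fin.elim0 j, hW⟩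
  | succ n IH =>
    intro t ht W hW
    by_cases hdist : NonunitDistinct O t
    · exact ⟨n + 1, t, le_rfl, ht, hdist, hW⟩
    · simp only [NonunitDistinct, not_forall] at hdist
      obtain ⟨j, l, _, htjl, hjl⟩ := hdist
      obtain ⟨d', t', hd', ht', hdt', hW'⟩ := IH (fun i => t (l.succAbove i))
        (isParamFamily_comp_succAbove O S t ht l) W
        (fun c hc => isMonomialIn_comp_succAbove O S t hjl htjl (hW c hc))
      exact ⟨d', t', hd'.trans (Nat.le_succ n), ht', hdt', hW'⟩

end Dedup

/-! # E · The kernel composition with Σ₁ discharged -/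

section CoreSigma

variable {k : Type} [Field k] {K : Type} [Field K] [Algebra k K]

/-- **THE KERNEL COMPOSITION of PART V.**  Toric ascent over a base `F₁` of transcendence degree `≤ 3`
carrying a regular affine model `B₀` of `O ∩ F₁` (the output of `regularBase_of_relLU`), from the
named fact CJS-2020 and the two printed engines Σ₁ (`MonoidalStep`) and Π₁ (`KK05NCVAscent`):
representations (K1') → initial chart making all coefficients monomials (CJS, `exists_initial_chart`)
→ Perron–Zariski upgrade to (V) by at most `3`-parameter merging (`valIndep_upgrade`, Lemma M) →
KK05 Thm. 4.1. [folklore] -/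
theorem toricAscent_core_sigma (hCJS : CossartJannsenSaito2020Embedded.{0})
    (hAsc : KK05NCVAscent) (O : ValuationSubring K) [hr : O.valuation.RankOne]
    (hk : ∀ c : k, algebraMap k K c ∈ O)
    (F₁ : IntermediateField k K) (htr : Algebra.trdeg k F₁ ≤ 3)
    (B₀ : Subalgebra k K) (hB₀O : B₀.toSubring ≤ O.toSubring)
    (hB₀F : (B₀ : Set K) ⊆ F₁.toSubfield) (hB₀fg : B₀.FG)
    (hfrac : ∀ y ∈ F₁.toSubfield, ∃ a ∈ B₀, ∃ b ∈ B₀, y = a / b)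
    (hreg : IsRegularLocalRing
      (Localization.AtPrime (Ideal.comap (Subring.inclusion hB₀O) (maximalIdeal O))))
    {ρ : ℕ} (x : Fin ρ → K) (hx : IsValIndepOver O F₁ x) (Z : Finset K)
    (hZ : ∀ z ∈ Z, z ∈ O ∧ z ∈ (toricField F₁ x).toSubfield) :
    ∃ (B : Subalgebra k K) (hB : B.toSubring ≤ O.toSubring),
      (B : Set K) ⊆ (toricField F₁ x).toSubfield ∧ (Z : Set K) ⊆ B ∧ B.FG ∧
      (∀ y ∈ (toricField F₁ x).toSubfield, ∃ a ∈ B, ∃ b ∈ B, y = a / b) ∧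
      IsRegularLocalRing
        (Localization.AtPrime (Ideal.comap (Subring.inclusion hB) (IsLocalRing.maximalIdeal O))) := by
  classical
  have hB₀F' : ∀ y, y ∈ B₀ → y ∈ F₁ := fun y hy =>
    (IntermediateField.mem_toSubfield _ _).mp (hB₀F hy)
  have hfrac' : ∀ y : K, y ∈ F₁ → ∃ a ∈ B₀, ∃ b ∈ B₀, b ≠ 0 ∧ y = a / b := by
    intro y hy
    rcases eq_or_ne y 0 with rfl | hy0
    · exact ⟨0, B₀.zero_mem, 1, B₀.one_mem, one_ne_zero, by simp⟩
    · obtain ⟨a, ha, b, hb, hab⟩ := hfrac y ((IntermediateField.mem_toSubfield _ _).mpr hy)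
      refine ⟨a, ha, b, hb, ?_, hab⟩
      rintro rfl
      rw [div_zero] at hab
      exact hy0 hab
  -- K1': integral representations of the elements of `Z`
  have hrep : ∀ z ∈ Z, ∃ P Q : MvPolynomial (Fin ρ) K, (∀ e, P.coeff e ∈ B₀) ∧
      (∀ e, Q.coeff e ∈ B₀) ∧ MvPolynomial.eval x Q ≠ 0 ∧
      z * MvPolynomial.eval x Q = MvPolynomial.eval x P := fun z hz =>
    exists_rep_integral F₁ B₀ hfrac' x (hZ z hz).2
  choose Pz Qz hPB hQB hQ0 hzeq using hrep
  -- the finite set of non-zero coefficients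
  let W : Finset K := Z.attach.biUnion fun z =>
    (Pz z.1 z.2).support.image (Pz z.1 z.2).coeff ∪ (Qz z.1 z.2).support.image (Qz z.1 z.2).coeff
  have hWP : ∀ z (hz : z ∈ Z), ∀ e ∈ (Pz z hz).support, (Pz z hz).coeff e ∈ W := by
    intro z hz e he
    exact Finset.mem_biUnion.mpr ⟨⟨z, hz⟩, Finset.mem_attach _ _,
      Finset.mem_union_left _ (Finset.mem_image.mpr ⟨e, he, rfl⟩)⟩
  have hWQ : ∀ z (hz : z ∈ Z), ∀ e ∈ (Qz z hz).support, (Qz z hz).coeff e ∈ W := by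
    intro z hz e he
    exact Finset.mem_biUnion.mpr ⟨⟨z, hz⟩, Finset.mem_attach _ _,
      Finset.mem_union_right _ (Finset.mem_image.mpr ⟨e, he, rfl⟩)⟩
  have hW : ∀ w ∈ W, w ∈ B₀ ∧ w ≠ 0 := by
    intro w hw
    obtain ⟨z, -, hw⟩ := Finset.mem_biUnion.mp hw
    rcases Finset.mem_union.mp hw with h | h
    · obtain ⟨e, he, rfl⟩ := Finset.mem_image.mp h
      exact ⟨hPB z.1 z.2 e, MvPolynomial.mem_support_iff.mp he⟩
    · obtain ⟨e, he, rfl⟩ := Finset.mem_image.mp h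
      exact ⟨hQB z.1 z.2 e, MvPolynomial.mem_support_iff.mp he⟩
  -- the initial chart (CJS) and the upgrade to (V) (Perron–Zariski, Σ₁)
  obtain ⟨S, d₀, t₀, hd3₀, -, hS, ht₀, hmono₀⟩ :=
    exists_initial_chart hCJS O F₁ htr B₀ hB₀O hB₀F' hB₀fg hfrac' hreg W hW
  -- Σ₁ hygiene (gen 19): make the family injective on its non-unit members
  obtain ⟨d, t, hdd, ht, hdt, hmono⟩ := exists_dedup_paramFamily O S t₀ ht₀ W hmono₀
  have hd3 : d ≤ 3 := hdd.trans hd3₀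
  obtain ⟨S₁, t₁, -, hS₁, ht₁, hmono₁, hV⟩ :=
    valIndep_upgradeD O monoidalStepD_holds hk F₁ hd3 S t hS ht hdt W hmono
  -- KK05 Thm. 4.1
  refine hAsc k K O hk F₁ S₁ hS₁ d t₁ ht₁ hV ρ x hx Z (fun z hz => (hZ z hz).1) fun z hz => ?_
  exact ⟨Pz z hz, Qz z hz, fun e he => hmono₁ _ (hWP z hz e he), fun e he => hmono₁ _ (hWQ z hz e he),
    hQ0 z hz, hzeq z hz⟩

/-- **`ToricAscentRk1 3` — Σ₁ DISCHARGED (gen 19).**  Supersedes the landed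
`toricAscentRk1_three (hCJS) (hStep : MonoidalStep) (hAsc)`: modulo the CJS named fact and the port Π₁ only. [folklore] -/
theorem toricAscentRk1_three_sigma (hCJS : CossartJannsenSaito2020Embedded.{0}) (hAsc : KK05NCVAscent) :
    ToricAscentRk1 3 := by
  intro p hp k K _ _ _ _ O hk hr F₁ hF₁fg htr hLU ρ x hx Z hZ
  obtain ⟨hr⟩ := hr
  obtain ⟨B₀, hB₀O, hB₀F, -, hB₀fg, hfrac, hreg⟩ := regularBase_of_relLU O hk F₁ hF₁fg hLU ∅ (by simp)
  exact toricAscent_core_sigma hCJS hAsc O hk F₁ htr B₀ hB₀O hB₀F hB₀fg hfrac hreg x hx Z hZ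

end CoreSigma

/-! # F · The cuts at base bound `3` with Σ₁ DISCHARGED (floor + CJS + Π₁; supersede the landed `…_perron`) -/

/-- **NEW CELL, DECIDED-MOD-(CP2019 floor + CJS-2020 named fact + Σ₁ + Π₁)**: at EVERY rung `n`, every
RANK-ONE valuation of a function field of transcendence degree `≤ n` in characteristic `p` (any ground
field) admitting a toric–dense presentation over a finitely generated subfield of transcendence degree
`≤ 3` admits relative local uniformization. [folklore] -/
theorem toricDenseLURk1_three_sigma (hCP : CossartPiltant2019LU3.{0})
    (hCJS : CossartJannsenSaito2020Embedded.{0}) (hAsc : KK05NCVAscent)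
    (n : ℕ) : ToricDenseLURk1 3 n :=
  toricDenseLURk1_of_toricAscentRk1 (toricAscentRk1_three_sigma hCJS hAsc) (luRel_three_of_cp hCP) n

/-- **THE g16 WINDOW-(ii) CUT, DECIDED-MOD-PORT**: `NonToricArchLU e 4 ↔ NonToricArchLU 3 4` for every
base bound `e ≤ 3` (in particular `NonToricArchLU 2 4 ↔ NonToricArchLU 3 4`, the g16/g17 statement
`nonToricArchLU_two_four_iff_three` with its hypothesis `ToricAscent 3` DISCHARGED in rank one). [folklore] -/
theorem nonToricArchLU_four_iff_three_sigma (hCP : CossartPiltant2019LU3.{0})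
    (hCJS : CossartJannsenSaito2020Embedded.{0}) (hAsc : KK05NCVAscent)
    {e : ℕ} (he : e ≤ 3) : NonToricArchLU e 4 ↔ NonToricArchLU 3 4 :=
  ⟨nonToricArchLU_mono he, fun h => nonToricArchLU_of_nonSepDenseNonAbh
    (nonSepDenseNonAbh_of_toric_cutRk1 (toricAscentRk1_three_sigma hCJS hAsc) (luRel_three_of_cp hCP) h)⟩

/-- `nonToricArchLU_two_four_iff_three_sigma`: Auxiliary step of this node's calculus, VERBATIM from the lens file
(see the module docstring); the statement is its type. [folklore] -/
theorem nonToricArchLU_two_four_iff_three_sigma (hCP : CossartPiltant2019LU3.{0})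
    (hCJS : CossartJannsenSaito2020Embedded.{0}) (hAsc : KK05NCVAscent) :
    NonToricArchLU 2 4 ↔ NonToricArchLU 3 4 :=
  nonToricArchLU_four_iff_three_sigma hCP hCJS hAsc (by omega)

/-- **THE LOCATED RESIDUAL**: rung 4 is exactly the TRUE non-toric residual `NonToricArchLU 3 4`. [folklore] -/
theorem luRel_four_iff_nonToric_three_sigma (hCP : CossartPiltant2019LU3.{0})
    (hCJS : CossartJannsenSaito2020Embedded.{0}) (hAsc : KK05NCVAscent) :
    LURel 4 ↔ NonToricArchLU 3 4 :=
  (luRel_four_iff_nonAbh_four hCP).trans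
    (nonSepDenseNonAbh_iff_nonToricRk1 (toricAscentRk1_three_sigma hCJS hAsc) (luRel_three_of_cp hCP) 4)

/-- … and, off the Kaplansky–Hensel locus (gen 17, port-free cut), exactly `NonKHToricArchLU 3 3 4`. [folklore] -/
theorem luRel_four_iff_nonKHToric_three_sigma (hCP : CossartPiltant2019LU3.{0})
    (hCJS : CossartJannsenSaito2020Embedded.{0}) (hAsc : KK05NCVAscent) :
    LURel 4 ↔ NonKHToricArchLU 3 3 4 :=
  (luRel_four_iff_nonToric_three_sigma hCP hCJS hAsc).trans (nonToric_two_four_iff_nonKH hCP 3)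

/-- `nonKH_three_four_iff_nonKHToric_sigma`: Auxiliary step of this node's calculus, VERBATIM from the lens file
(see the module docstring); the statement is its type. [folklore] -/
theorem nonKH_three_four_iff_nonKHToric_sigma (hCP : CossartPiltant2019LU3.{0})
    (hCJS : CossartJannsenSaito2020Embedded.{0}) (hAsc : KK05NCVAscent) :
    NonKHArchLU 3 4 ↔ NonKHToricArchLU 3 3 4 :=
  nonKH_iff_nonKHToricRk1 (toricAscentRk1_three_sigma hCJS hAsc) (luRel_three_of_cp hCP) 4

/-- **`closes_sigma` — ROOT BY NAME (deciding theorem of this node).**  Cossart–Piltant floor (print) +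
CJS-2020 embedded resolution of surfaces in excellent threefolds (NAMED FACT, tree) + the monoidal step Σ₁
(print) + the KK05 (NC)+(V) ascent Π₁ (print) + the non-toric, non-Kaplansky–Hensel residuals with base
bounds `(3, 3)` in transcendence degree `≥ 4` + the route's patching crux 0642 ⇒ `ResolutionOfSingularities`. [folklore] -/
theorem closes_sigma (hCP : CossartPiltant2019LU3.{0}) (hCJS : CossartJannsenSaito2020Embedded.{0})
    (hAsc : KK05NCVAscent) (hN : ∀ d, 4 ≤ d → NonKHToricArchLU 3 3 d)
    (h₃ : Valuative.PatchingRel) : _root_.ResolutionOfSingularities :=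
  closes_kaplansky hCP (fun d hd =>
    (nonKH_iff_nonKHToricRk1 (toricAscentRk1_three_sigma hCJS hAsc) (luRel_three_of_cp hCP) d).2
      (hN d hd)) h₃

/-- The same through the route's own deciding theorem `Valuative.closes`. [folklore] -/
theorem closes_sigma' (hCP : CossartPiltant2019LU3.{0}) (hCJS : CossartJannsenSaito2020Embedded.{0})
    (hAsc : KK05NCVAscent) (hN : ∀ d, 4 ≤ d → NonKHToricArchLU 3 3 d)
    (h₄ : Valuative.TorsorToLurel) (h₃ : Valuative.PatchingRel) : _root_.ResolutionOfSingularities :=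
  Valuative.closes
    (luAlphaPTorsor_of_nonSepDense hCP (fun d hd => (nonSepDenseArchLU_iff_nonAbh d).2
      (nonSepDenseNonAbh_of_toric_cutRk1 (toricAscentRk1_three_sigma hCJS hAsc) (luRel_three_of_cp hCP)
        (nonToric_of_kh_cut (luRel_three_of_cp hCP) (hN d hd))))) h₄ h₃

/-- The toric-only version (no Kaplansky–Hensel cut): residuals `NonToricArchLU 3 d`, `d ≥ 4`. [folklore] -/
theorem closes_sigma_toric (hCP : CossartPiltant2019LU3.{0})
    (hCJS : CossartJannsenSaito2020Embedded.{0}) (hAsc : KK05NCVAscent)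
    (hN : ∀ d, 4 ≤ d → NonToricArchLU 3 d) (h₃ : Valuative.PatchingRel) :
    _root_.ResolutionOfSingularities :=
  closes_final hCP (fun d hd => nonSepDenseNonAbh_of_toric_cutRk1 (toricAscentRk1_three_sigma hCJS hAsc)
    (luRel_three_of_cp hCP) (hN d hd)) h₃

/-- `root_iff_nonKHToric_sigma`: Auxiliary step of this node's calculus, VERBATIM from the lens file (see the module
docstring); the statement is its type. [folklore] -/
theorem root_iff_nonKHToric_sigma (hCP : CossartPiltant2019LU3.{0})
    (hCJS : CossartJannsenSaito2020Embedded.{0}) (hAsc : KK05NCVAscent)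
    (h₃ : Valuative.PatchingRel) :
    _root_.ResolutionOfSingularities ↔ ∀ d, 4 ≤ d → NonKHToricArchLU 3 3 d :=
  ⟨fun hS d _ => nonKHToricArchLU_of_root hS 3 3 d, fun hN => closes_sigma hCP hCJS hAsc hN h₃⟩

/-- `root_iff_nonToric_sigma`: Auxiliary step of this node's calculus, VERBATIM from the lens file (see the module
docstring); the statement is its type. [folklore] -/
theorem root_iff_nonToric_sigma (hCP : CossartPiltant2019LU3.{0})
    (hCJS : CossartJannsenSaito2020Embedded.{0}) (hAsc : KK05NCVAscent)
    (h₃ : Valuative.PatchingRel) :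
    _root_.ResolutionOfSingularities ↔ ∀ d, 4 ≤ d → NonToricArchLU 3 d :=
  ⟨fun hS d _ => nonToricArchLU_of_root hS 3 d, fun hN => closes_sigma_toric hCP hCJS hAsc hN h₃⟩

/-- Summary (residual-level): modulo floor + CJS + Σ₁ + Π₁ the gen-15 residual family IS the true
non-toric residual family: `(∀ d ≥ 4, NonSepDenseNonAbhArchLU d) ↔ (∀ d ≥ 4, NonToricArchLU 3 d)`. [folklore] -/
theorem nonSepDenseNonAbh_iff_nonToric_three_sigma (hCP : CossartPiltant2019LU3.{0})
    (hCJS : CossartJannsenSaito2020Embedded.{0}) (hAsc : KK05NCVAscent) :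
    (∀ d, 4 ≤ d → NonSepDenseNonAbhArchLU d) ↔ ∀ d, 4 ≤ d → NonToricArchLU 3 d :=
  ⟨fun hA d hd => nonToricArchLU_of_nonSepDenseNonAbh (hA d hd),
    fun hN d hd => nonSepDenseNonAbh_of_toric_cutRk1 (toricAscentRk1_three_sigma hCJS hAsc)
      (luRel_three_of_cp hCP) (hN d hd)⟩

/-- Σ₁′ is a theorem: `MonoidalStepD ↔ True`. [folklore] -/
theorem monoidalStepD_iff_true : MonoidalStepD ↔ True :=
  ⟨fun _ => trivial, fun _ => monoidalStepD_holds⟩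

end Summit.ResolutionOfSingularities.ResolutionOfSingularities.Theorems.DefectlessLadder
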